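import Mathlib
import HarnessLib
import Literature.Analysis.FluidPDE.LocalTypeI
import Literature.Analysis.FluidPDE.LocalTypeILscPressure

/-!
# The slice oscillation estimate of the local pressure expansion

Crux `ForcedSymmetry` (stmt-NavierStokesRegularity-4052), line `recurrent-closing`, stub
`stub_sliceOscillation`: the pure real-analysis slice estimate in the KNSS local pressure
expansion. A pressure slice `q` on the ball `B(x₀, 2)` splits as constant + near part `p₁`
(small in `L²(ℝ³)`) + far part `p₂` (small Lipschitz constant on the ball); then the
`L^{3/2}` mean oscillation of `q` on the unit ball (Albritton–Barker's quantity `D`) is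
controlled by `‖p₁‖₂^{3/2} + Lip(p₂)^{3/2}`.

Proof: subtract the constant `k = c + p₂ x₀`; on `B(x₀, 1)`, `|p₂ x - p₂ x₀| ≤ B` by the mean
value inequality on the convex ball `B(x₀, 2)`; Hölder `L² ⊂ L^{3/2}` on the unit ball; and
`∫ |q - [q]|^{3/2} ≤ 4 ∫ |q - k|^{3/2}` for any constant `k` (Jensen for the average).
-/

noncomputable section
set_option linter.dupNamespace false

open MeasureTheory Set Metric Function
open Literature.Analysis.FluidPDE
open scoped ENNReal NNReal

namespace Summit.NavierStokesRegularity.NavierStokesRegularity.Theorems.SymmetryModuliCountForcedSymmetry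

/-- **Mean oscillation versus distance to a constant.** On a set `s` with `0 < μ s < ∞`, for
`f` integrable on `s` and any constant `k`,
`∫_s |f - ⨍_s f|^{3/2} ≤ 4 ∫_s |f - k|^{3/2}` (`|a + b|^{3/2} ≤ √2 (|a|^{3/2} + |b|^{3/2})`
and Jensen `|⨍_s (f - k)|^{3/2} ≤ ⨍_s |f - k|^{3/2}`). [folklore] -/
theorem lintegral_sub_setAverage_rpow_le_four_mul {α : Type*} [MeasurableSpace α]
    {μ : Measure α} {s : Set α} (hs0 : μ s ≠ 0) (hs : μ s ≠ ∞) {f : α → ℝ}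
    (hf : IntegrableOn f s μ) (k : ℝ) :
    ∫⁻ x in s, ‖f x - ⨍ y in s, f y ∂μ‖ₑ ^ (3 / 2 : ℝ) ∂μ ≤
      4 * ∫⁻ x in s, ‖f x - k‖ₑ ^ (3 / 2 : ℝ) ∂μ := by
  have havg : (⨍ y in s, f y ∂μ) - k = ⨍ y in s, (f y - k) ∂μ :=
    (Literature.Analysis.FunctionSpaces.setAverage_sub_const hs0 hs hf k).symm
  have hmeas : AEStronglyMeasurable (fun y => f y - k) (μ.restrict s) :=
    hf.aestronglyMeasurable.sub aestronglyMeasurable_const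
  -- pointwise splitting
  have hpt : ∀ x, ‖f x - ⨍ y in s, f y ∂μ‖ₑ ^ (3 / 2 : ℝ) ≤
      2 * ‖f x - k‖ₑ ^ (3 / 2 : ℝ) + 2 * ‖⨍ y in s, (f y - k) ∂μ‖ₑ ^ (3 / 2 : ℝ) := by
    intro x
    have hsplit : f x - ⨍ y in s, f y ∂μ = (f x - k) - ⨍ y in s, (f y - k) ∂μ := by
      rw [← havg]; ring
    rw [hsplit]
    calc ‖(f x - k) - ⨍ y in s, (f y - k) ∂μ‖ₑ ^ (3 / 2 : ℝ)
        ≤ (‖f x - k‖ₑ + ‖⨍ y in s, (f y - k) ∂μ‖ₑ) ^ (3 / 2 : ℝ) := by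
          gcongr; exact enorm_sub_le
      _ ≤ 2 ^ ((3 / 2 : ℝ) - 1) * (‖f x - k‖ₑ ^ (3 / 2 : ℝ) +
            ‖⨍ y in s, (f y - k) ∂μ‖ₑ ^ (3 / 2 : ℝ)) :=
          ENNReal.rpow_add_le_mul_rpow_add_rpow _ _ (by norm_num)
      _ ≤ 2 * (‖f x - k‖ₑ ^ (3 / 2 : ℝ) + ‖⨍ y in s, (f y - k) ∂μ‖ₑ ^ (3 / 2 : ℝ)) := by
          gcongr
          calc (2 : ℝ≥0∞) ^ ((3 / 2 : ℝ) - 1) ≤ 2 ^ (1 : ℝ) :=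
                ENNReal.rpow_le_rpow_of_exponent_le (by norm_num) (by norm_num)
            _ = 2 := ENNReal.rpow_one _
      _ = _ := by ring
  have hfm : AEMeasurable (fun x => 2 * ‖f x - k‖ₑ ^ (3 / 2 : ℝ)) (μ.restrict s) :=
    (hmeas.aemeasurable.enorm.pow_const _).const_mul _
  calc ∫⁻ x in s, ‖f x - ⨍ y in s, f y ∂μ‖ₑ ^ (3 / 2 : ℝ) ∂μ
      ≤ ∫⁻ x in s, (2 * ‖f x - k‖ₑ ^ (3 / 2 : ℝ) +
          2 * ‖⨍ y in s, (f y - k) ∂μ‖ₑ ^ (3 / 2 : ℝ)) ∂μ := lintegral_mono fun x => hpt x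
    _ = 2 * (∫⁻ x in s, ‖f x - k‖ₑ ^ (3 / 2 : ℝ) ∂μ) +
          2 * (‖⨍ y in s, (f y - k) ∂μ‖ₑ ^ (3 / 2 : ℝ) * μ s) := by
        rw [lintegral_add_left' hfm, lintegral_const_mul' _ _ ENNReal.ofNat_ne_top,
          lintegral_const, Measure.restrict_apply_univ, mul_assoc]
    _ ≤ 2 * (∫⁻ x in s, ‖f x - k‖ₑ ^ (3 / 2 : ℝ) ∂μ) +
          2 * (((μ s)⁻¹ * ∫⁻ x in s, ‖f x - k‖ₑ ^ (3 / 2 : ℝ) ∂μ) * μ s) := by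
        gcongr
        exact enorm_setAverage_rpow_le hs (by norm_num) hmeas
    _ = 4 * ∫⁻ x in s, ‖f x - k‖ₑ ^ (3 / 2 : ℝ) ∂μ := by
        rw [mul_comm ((μ s)⁻¹ * _) (μ s), ← mul_assoc (μ s), ENNReal.mul_inv_cancel hs0 hs,
          one_mul, ← two_mul, ← mul_assoc]
        norm_num

/-- **Hölder `L² ⊂ L^{3/2}` on a set**, `lintegral` form: for an a.e.-measurable
`f : α → ℝ≥0∞` on `s`, `∫_s f^{3/2} ≤ (∫_s f²)^{3/4} μ(s)^{1/4}` (Hölder with the exponents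
`4/3` and `4` against the constant function `1`). [folklore] -/
theorem setLIntegral_rpow_threeHalves_le {α : Type*} [MeasurableSpace α] (μ : Measure α)
    (s : Set α) {f : α → ℝ≥0∞} (hf : AEMeasurable f (μ.restrict s)) :
    ∫⁻ x in s, f x ^ (3 / 2 : ℝ) ∂μ ≤ (∫⁻ x in s, f x ^ 2 ∂μ) ^ (3 / 4 : ℝ) * μ s ^ (1 / 4 : ℝ) := by
  have hpq : (4 / 3 : ℝ).HolderConjugate 4 := Real.holderConjugate_iff.2 ⟨by norm_num, by norm_num⟩
  have key := ENNReal.lintegral_mul_le_Lp_mul_Lq (μ.restrict s) hpq (hf.pow_const (3 / 2 : ℝ))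
    (g := fun _ => (1 : ℝ≥0∞)) aemeasurable_const
  simp only [Pi.mul_apply, mul_one, ENNReal.one_rpow, lintegral_const,
    Measure.restrict_apply_univ, one_mul] at key
  have e1 : ∀ y, (f y ^ (3 / 2 : ℝ)) ^ (4 / 3 : ℝ) = f y ^ 2 := fun y => by
    rw [← ENNReal.rpow_mul, show (3 / 2 : ℝ) * (4 / 3) = (2 : ℕ) by norm_num, ENNReal.rpow_natCast]
  simp only [e1] at key
  convert key using 2; norm_num

/-- **Sub-stub 1b — the slice oscillation estimate (pure real analysis).**  There is `c₁ ≥ 0`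
such that whenever a function `q`, continuous on `B(x₀,2)`, splits there as `q = c + p₁ + p₂`
with `p₁ ∈ L²(ℝ³)`, `‖p₁‖₂² ≤ A`, and `p₂` differentiable on `B(x₀,2)` with `‖∇p₂‖ ≤ B`, then
`∫_{B(x₀,1)} |q − [q]_{B(x₀,1)}|^{3/2} ≤ c₁ (A^{3/4} + B^{3/2})` (subtract the constant
`c + p₂(x₀)`: `|p₂(x) − p₂(x₀)| ≤ B` on the unit ball by the mean value inequality, Hölder
`L² ⊂ L^{3/2}` on the ball, and `‖q − [q]‖_{3/2}^{3/2} ≤ 4 ‖q − k‖_{3/2}^{3/2}` for any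
constant `k`). The constant is `c₁ = 8 (1 + |B(0,1)|)`. [folklore] -/
theorem stub_sliceOscillation :
    ∃ c₁ : ℝ, 0 ≤ c₁ ∧ ∀ (q p₁ p₂ : EuclideanSpace ℝ (Fin 3) → ℝ) (c A B : ℝ) (x₀ : EuclideanSpace ℝ (Fin 3)),
      ContinuousOn q (ball x₀ 2) →
      (∀ x ∈ ball x₀ 2, q x = c + p₁ x + p₂ x) → MemLp p₁ 2 volume → ∫ x, p₁ x ^ 2 ≤ A →
      (∀ x ∈ ball x₀ 2, DifferentiableAt ℝ p₂ x ∧ ‖fderiv ℝ p₂ x‖ ≤ B) →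
      ∫⁻ x in ball x₀ 1, ‖q x - ⨍ y in ball x₀ 1, q y‖ₑ ^ (3 / 2 : ℝ) ≤
        ENNReal.ofReal (c₁ * (A ^ (3 / 4 : ℝ) + B ^ (3 / 2 : ℝ))) := by
  set V : ℝ≥0∞ := volume (ball (0 : EuclideanSpace ℝ (Fin 3)) 1) with hV
  have hVtop : V ≠ ∞ := measure_ball_lt_top.ne
  refine ⟨8 * (1 + V.toReal), by positivity, ?_⟩
  intro q p₁ p₂ c A B x₀ hq hsplit hp₁ hA hp₂
  -- basic facts
  have hx₀ : x₀ ∈ ball x₀ 2 := mem_ball_self (by norm_num)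
  have hB0 : 0 ≤ B := (norm_nonneg _).trans (hp₂ x₀ hx₀).2
  have hA0 : 0 ≤ A := (integral_nonneg fun x => sq_nonneg (p₁ x)).trans hA
  have hsub : ball x₀ 1 ⊆ ball x₀ 2 := ball_subset_ball (by norm_num)
  have hvol : volume (ball x₀ 1) = V := Measure.addHaar_ball_center volume x₀ 1
  have hV0 : volume (ball x₀ 1) ≠ 0 := (measure_ball_pos volume x₀ one_pos).ne'
  have hVtop' : volume (ball x₀ 1) ≠ ∞ := measure_ball_lt_top.ne
  -- integrability of `q` on the unit ball
  have hqint : IntegrableOn q (ball x₀ 1) volume :=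
    ((hq.mono (closedBall_subset_ball (by norm_num))).integrableOn_compact
      (isCompact_closedBall x₀ 1)).mono_set ball_subset_closedBall
  -- the mean value inequality: `|p₂ x - p₂ x₀| ≤ B` on the unit ball
  have hmv : ∀ x ∈ ball x₀ 1, ‖p₂ x - p₂ x₀‖ ≤ B := by
    intro x hx
    calc ‖p₂ x - p₂ x₀‖ ≤ B * ‖x - x₀‖ :=
          (convex_ball x₀ 2).norm_image_sub_le_of_norm_fderiv_le (fun y hy => (hp₂ y hy).1)
            (fun y hy => (hp₂ y hy).2) hx₀ (hsub hx)
      _ ≤ B * 1 := by gcongr; exact (mem_ball_iff_norm.1 hx).le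
      _ = B := mul_one B
  -- step 1: oscillation versus the constant `k = c + p₂ x₀`
  set k : ℝ := c + p₂ x₀ with hk
  have step1 := lintegral_sub_setAverage_rpow_le_four_mul hV0 hVtop' hqint k
  -- step 2: pointwise on the unit ball
  have hpt : ∀ x ∈ ball x₀ 1, ‖q x - k‖ₑ ^ (3 / 2 : ℝ) ≤
      2 * ‖p₁ x‖ₑ ^ (3 / 2 : ℝ) + 2 * ENNReal.ofReal B ^ (3 / 2 : ℝ) := by
    intro x hx
    have h1 : q x - k = p₁ x + (p₂ x - p₂ x₀) := by rw [hsplit x (hsub hx), hk]; ring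
    have h2 : ‖q x - k‖ₑ ≤ ‖p₁ x‖ₑ + ENNReal.ofReal B := by
      rw [h1]
      calc ‖p₁ x + (p₂ x - p₂ x₀)‖ₑ ≤ ‖p₁ x‖ₑ + ‖p₂ x - p₂ x₀‖ₑ := enorm_add_le _ _
        _ ≤ ‖p₁ x‖ₑ + ENNReal.ofReal B := by
          gcongr
          rw [← ofReal_norm]
          exact ENNReal.ofReal_le_ofReal (hmv x hx)
    calc ‖q x - k‖ₑ ^ (3 / 2 : ℝ) ≤ (‖p₁ x‖ₑ + ENNReal.ofReal B) ^ (3 / 2 : ℝ) := by gcongr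
      _ ≤ 2 ^ ((3 / 2 : ℝ) - 1) * (‖p₁ x‖ₑ ^ (3 / 2 : ℝ) + ENNReal.ofReal B ^ (3 / 2 : ℝ)) :=
          ENNReal.rpow_add_le_mul_rpow_add_rpow _ _ (by norm_num)
      _ ≤ 2 * (‖p₁ x‖ₑ ^ (3 / 2 : ℝ) + ENNReal.ofReal B ^ (3 / 2 : ℝ)) := by
          gcongr
          calc (2 : ℝ≥0∞) ^ ((3 / 2 : ℝ) - 1) ≤ 2 ^ (1 : ℝ) :=
                ENNReal.rpow_le_rpow_of_exponent_le (by norm_num) (by norm_num)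
            _ = 2 := ENNReal.rpow_one _
      _ = _ := by ring
  -- step 3: integrate over the unit ball
  have hp₁m : AEMeasurable (fun x => ‖p₁ x‖ₑ) (volume.restrict (ball x₀ 1)) :=
    hp₁.aestronglyMeasurable.aemeasurable.enorm.restrict
  have step3 : ∫⁻ x in ball x₀ 1, ‖q x - k‖ₑ ^ (3 / 2 : ℝ) ≤
      2 * (∫⁻ x in ball x₀ 1, ‖p₁ x‖ₑ ^ (3 / 2 : ℝ)) + 2 * ENNReal.ofReal B ^ (3 / 2 : ℝ) * V := by
    calc ∫⁻ x in ball x₀ 1, ‖q x - k‖ₑ ^ (3 / 2 : ℝ)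
        ≤ ∫⁻ x in ball x₀ 1, (2 * ‖p₁ x‖ₑ ^ (3 / 2 : ℝ) + 2 * ENNReal.ofReal B ^ (3 / 2 : ℝ)) :=
          setLIntegral_mono' measurableSet_ball fun x hx => hpt x hx
      _ = 2 * (∫⁻ x in ball x₀ 1, ‖p₁ x‖ₑ ^ (3 / 2 : ℝ)) + 2 * ENNReal.ofReal B ^ (3 / 2 : ℝ) * V := by
          rw [lintegral_add_left' ((hp₁m.pow_const _).const_mul _),
            lintegral_const_mul' _ _ ENNReal.ofNat_ne_top, lintegral_const,
            Measure.restrict_apply_univ, hvol]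
  -- step 4: Hölder `L² ⊂ L^{3/2}` on the unit ball and the `L²` bound
  have hsq : ∫⁻ x in ball x₀ 1, ‖p₁ x‖ₑ ^ 2 ≤ ENNReal.ofReal A := by
    calc ∫⁻ x in ball x₀ 1, ‖p₁ x‖ₑ ^ 2 ≤ ∫⁻ x, ‖p₁ x‖ₑ ^ 2 := setLIntegral_le_lintegral _ _
      _ = ENNReal.ofReal (∫ x, p₁ x ^ 2) := by
          rw [ofReal_integral_eq_lintegral_ofReal hp₁.integrable_sq (ae_of_all _ fun x => sq_nonneg _)]
          refine lintegral_congr fun x => ?_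
          rw [← ofReal_norm, ← ENNReal.ofReal_pow (norm_nonneg _), Real.norm_eq_abs, sq_abs]
      _ ≤ ENNReal.ofReal A := ENNReal.ofReal_le_ofReal hA
  have step4 : ∫⁻ x in ball x₀ 1, ‖p₁ x‖ₑ ^ (3 / 2 : ℝ) ≤
      ENNReal.ofReal A ^ (3 / 4 : ℝ) * V ^ (1 / 4 : ℝ) := by
    have h := setLIntegral_rpow_threeHalves_le volume (ball x₀ 1) hp₁m
    rw [hvol] at h
    exact h.trans (by gcongr)
  -- the volume factors
  have hV14 : V ^ (1 / 4 : ℝ) ≤ 1 + V := by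
    rcases le_total V 1 with h | h
    · exact (ENNReal.rpow_le_one h (by norm_num)).trans le_self_add
    · calc V ^ (1 / 4 : ℝ) ≤ V ^ (1 : ℝ) := ENNReal.rpow_le_rpow_of_exponent_le h (by norm_num)
        _ = V := ENNReal.rpow_one V
        _ ≤ 1 + V := le_add_self
  have hV1 : V ≤ 1 + V := le_add_self
  -- assembly
  calc ∫⁻ x in ball x₀ 1, ‖q x - ⨍ y in ball x₀ 1, q y‖ₑ ^ (3 / 2 : ℝ)
      ≤ 4 * ∫⁻ x in ball x₀ 1, ‖q x - k‖ₑ ^ (3 / 2 : ℝ) := step1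
    _ ≤ 4 * (2 * (ENNReal.ofReal A ^ (3 / 4 : ℝ) * V ^ (1 / 4 : ℝ)) +
          2 * ENNReal.ofReal B ^ (3 / 2 : ℝ) * V) := by
        gcongr 4 * ?_
        exact step3.trans (by gcongr)
    _ ≤ 4 * (2 * (ENNReal.ofReal A ^ (3 / 4 : ℝ) * (1 + V)) +
          2 * ENNReal.ofReal B ^ (3 / 2 : ℝ) * (1 + V)) := by
        gcongr
    _ = ENNReal.ofReal (8 * (1 + V.toReal) * (A ^ (3 / 4 : ℝ) + B ^ (3 / 2 : ℝ))) := by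
        rw [ENNReal.ofReal_mul (by positivity), ENNReal.ofReal_mul (by norm_num),
          ENNReal.ofReal_add zero_le_one ENNReal.toReal_nonneg, ENNReal.ofReal_toReal hVtop,
          ENNReal.ofReal_add (Real.rpow_nonneg hA0 _) (Real.rpow_nonneg hB0 _),
          ← ENNReal.ofReal_rpow_of_nonneg hA0 (by norm_num),
          ← ENNReal.ofReal_rpow_of_nonneg hB0 (by norm_num), ENNReal.ofReal_one,
          ENNReal.ofReal_ofNat]
        ring

end Summit.NavierStokesRegularity.NavierStokesRegularity.Theorems.SymmetryModuliCountForcedSymmetry
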